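import Literature.Geometry.Lorentzian.TameBreathingCurve
import Literature.Geometry.Lorentzian.AFEndUnbreathe
import Literature.Geometry.Lorentzian.TameGenericityLocal

/-!
# The gauge shear (registered stub `stub_shearInjImm`, line `Sketch` =
unwind-the-threshold-from-scri, crux `PhotonSphereChannels.TameCensorship`,
item stmt-FinalStateConjecture-17431)

For a property `P` of initial data preserved under re-indexing an admissible datum by a
diffeomorphism of `Σ` (`InitialDataSet.comap` along a homeomorphism smooth with injective
differentials, inverse likewise), every jointly smooth one-parameter family `G` of admissible data
whose members with `0 < ‖c‖ < ε` have `P` is sheared into a jointly smooth family `F` through the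
same base datum, INJECTIVE and IMMERSED at `0`, admissible, with `P` at every `c ≠ 0`, whose member
at `c` agrees with the reparametrised member `G (φ c)` (`φ` smooth, `φ 0 = 0`) off one compact set.

Construction. Far out on the asymptotically flat end `e` of `G 0` sits a coordinate ball
`ball z₀ 1`, `‖z₀‖ = R + 3` (`AFEnd.BreathingData`), with centre `x₀ = Φₑ z₀` and the tangent
vector `v₀ = e₀` there. Put `A c := h_{G c}(x₀)(v₀, v₀)` (smooth in `c`, positive at `0`) and

  `F₀ c := (breathe (σ (μ c₀)))^* (G c)`   (`AFEnd.breatheFamily B (G c) (μ * c 0)`),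

the pull-back of `G c` along the breathing diffeomorphism of `X` supported in the ball, the
amplitude `μ c₀` driven by the parameter. The centre marker is
`h_{F₀ c}(x₀)(v₀, v₀) = (1 + σ(μ c₀))² A c` (`breatheFamily_h_inner_center`), whose `c`-derivative
at `0` is `2 μ σ'(0) A 0 + ∂A(0)`; the real constant `μ` is CHOSEN so that this is `2 σ'(0) A 0 > 0`
(`marker_shear`). Hence `F₀` is immersed at `0`, and the marker is strictly monotone on a parameter
ball `‖c‖ < δ` (continuity of the derivative, mean value theorem), so `F₀` is injective there.
Finally `F := F₀ ∘ φ`, `φ` the radial contraction of `ℝ¹` into the `min ε δ`-ball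
(`exists_contDiff_radialContraction`): jointly smooth (`AFEnd.contMDiff_breatheFamily_family_h/k`),
injective, immersed (`IsImmersedAtZero.comp_of_injective_fderiv`), `F 0 = G 0` (`breathe 0 = id`),
admissible (`breatheCurve_mem_admissibleVacuumData`), equal to `G (φ c)` off the compact core
`breatheCore e z₀ 1` (`breatheFamily_eq_of_not_mem_core`), and with `P` at `c ≠ 0` because
`F c = (G (φ c)).comap (breatheHomeomorph …)` definitionally, `0 < ‖φ c‖ < ε`, and `P` is preserved
(`hP`; the inverse `unbreathe` is smooth, `contMDiff_unbreathe`, with injective differentials by the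
chain rule against `breathe ∘ unbreathe = id`).
Stub-worker of the line lead prover-line-stmt-FinalStateConjecture-17431-0, 2026-08-17.
-/

-- the summit-side namespace `Summit.FinalStateConjecture.FinalStateConjecture.…` (summit = problem)
-- repeats a component by design, which the `dupNamespace` linter would flag on every decl.
set_option linter.dupNamespace false

noncomputable section

open Literature.Geometry.Lorentzian Literature.Geometry.Lorentzian.AFEnd
open scoped Manifold ContDiff Topology
open Filter Set Function Bundle

namespace Summit.FinalStateConjecture.FinalStateConjecture.Theorems.PhotonSphereChannels.TameCensorshipUnwind

/-! ### Calculus on the parameter line `ℝ¹` -/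

/-- **The marker shear.** For a smooth `A : ℝ¹ → ℝ` with `A 0 > 0` and a smooth `σ : ℝ → ℝ` with
`σ 0 = 0`, `σ'(0) = s > 0`, there is a real constant `μ` such that the marker
`m c := (1 + σ (μ c₀))² A c` has non-vanishing derivative at `0` in every direction `v ≠ 0` of `ℝ¹`
and is injective on a parameter ball `‖c‖ < δ`. Indeed along the basis vector,
`∂ m(0) = 2 s μ A 0 + ∂ A(0)`, and `μ := 1 − ∂A(0) / (2 s A 0)` makes it `2 s A 0 > 0`; the
derivative stays positive near `0` (it is continuous), so `m` is strictly monotone there (mean value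
theorem). -/
private theorem marker_shear {σ : ℝ → ℝ} (hσ : ContDiff ℝ ∞ σ) {s : ℝ} (hσ' : HasDerivAt σ s 0)
    (hs : 0 < s) (hσ0 : σ 0 = 0) {A : EuclideanSpace ℝ (Fin 1) → ℝ} (hA : ContDiff ℝ ∞ A)
    (hA0 : 0 < A 0) :
    ∃ μ : ℝ,
      (∀ v : EuclideanSpace ℝ (Fin 1), v ≠ 0 →
        fderiv ℝ (fun c : EuclideanSpace ℝ (Fin 1) ↦ (1 + σ (μ * c 0)) ^ 2 * A c) 0 v ≠ 0) ∧
      ∃ δ : ℝ, 0 < δ ∧ ∀ c c' : EuclideanSpace ℝ (Fin 1), ‖c‖ < δ → ‖c'‖ < δ →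
        (1 + σ (μ * c 0)) ^ 2 * A c = (1 + σ (μ * c' 0)) ^ 2 * A c' → c = c' := by
  -- the basis vector of `ℝ¹` and the coordinate `c ↦ c 0`
  set e₀ : EuclideanSpace ℝ (Fin 1) := EuclideanSpace.single (0 : Fin 1) (1 : ℝ) with he₀
  have he₀t : ∀ t : ℝ, (t • e₀) 0 = t := fun t ↦ by
    simp [he₀]
  have hce₀ : ∀ c : EuclideanSpace ℝ (Fin 1), (c 0) • e₀ = c := fun c ↦ by
    ext i
    fin_cases i
    exact he₀t (c 0)
  have hne₀ : ‖e₀‖ = 1 := by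
    rw [he₀, PiLp.norm_single, norm_one]
  have hnorm : ∀ c : EuclideanSpace ℝ (Fin 1), ‖c‖ = |c 0| := fun c ↦ by
    have h := congrArg norm (hce₀ c)
    rw [norm_smul, hne₀, mul_one, Real.norm_eq_abs] at h
    exact h.symm
  -- the marker read along the basis vector: `m₁ t = (1 + σ (μ t))² A₁ t`, `A₁ t = A (t e₀)`
  set A₁ : ℝ → ℝ := fun t ↦ A (t • e₀) with hA₁
  have hA₁s : ContDiff ℝ ∞ A₁ := hA.comp (contDiff_id.smul contDiff_const)
  have hA₁0 : A₁ 0 = A 0 := by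
    simp [hA₁]
  set a' : ℝ := deriv A₁ 0 with ha'
  set κ : ℝ := 2 * s * A 0 with hκ
  have hκ0 : 0 < κ := by positivity
  -- THE CHOICE of the shear rate
  set μ : ℝ := 1 - a' / κ with hμ
  have hμκ : κ * μ + a' = κ := by
    rw [hμ]
    field_simp
    ring
  set m₁ : ℝ → ℝ := fun t ↦ (1 + σ (μ * t)) ^ 2 * A₁ t with hm₁
  have hm_eq : (fun c : EuclideanSpace ℝ (Fin 1) ↦ (1 + σ (μ * c 0)) ^ 2 * A c) =
      fun c ↦ m₁ (c 0) := by
    funext c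
    show (1 + σ (μ * c 0)) ^ 2 * A c = (1 + σ (μ * c 0)) ^ 2 * A ((c 0) • e₀)
    rw [hce₀ c]
  have hm₁s : ContDiff ℝ ∞ m₁ :=
    ((contDiff_const.add (hσ.comp (contDiff_const.mul contDiff_id))).pow 2).mul hA₁s
  -- the derivative of `m₁` at `0` is `κ μ + a' = κ > 0`
  have h1 : HasDerivAt (fun t : ℝ ↦ μ * t) μ 0 := by
    simpa using (hasDerivAt_id (0 : ℝ)).const_mul μ
  have h2 : HasDerivAt σ s (μ * 0) := by rwa [mul_zero]
  have hσμ : HasDerivAt (fun t : ℝ ↦ σ (μ * t)) (s * μ) 0 := h2.comp 0 h1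
  have hA₁d : HasDerivAt A₁ a' 0 := (hA₁s.differentiable (by simp) 0).hasDerivAt
  have hm₁d : HasDerivAt m₁
      ((2 : ℕ) * (1 + σ (μ * 0)) ^ (2 - 1) * (s * μ) * A₁ 0 + (1 + σ (μ * 0)) ^ 2 * a') 0 :=
    ((hσμ.const_add 1).pow 2).mul hA₁d
  have hderiv0 : deriv m₁ 0 = κ := by
    rw [hm₁d.deriv, mul_zero, hσ0, hA₁0]
    have h3 :
        ((2 : ℕ) : ℝ) * (1 + 0) ^ (2 - 1) * (s * μ) * A 0 + (1 + 0) ^ 2 * a' = κ * μ + a' := by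
      rw [hκ]
      norm_num
      ring
    rw [h3, hμκ]
  -- the derivative stays positive on a ball, on which `m₁` is strictly monotone
  have hC1 : ContDiff ℝ 1 m₁ := hm₁s.of_le (by exact_mod_cast le_top)
  have hcont : Continuous (deriv m₁) := hC1.continuous_deriv le_rfl
  have hev : ∀ᶠ t in 𝓝 (0 : ℝ), 0 < deriv m₁ t := by
    have h := hcont.tendsto 0
    rw [hderiv0] at h
    exact Filter.Tendsto.eventually_const_lt hκ0 h
  obtain ⟨δ, hδ, hδ'⟩ := Metric.eventually_nhds_iff_ball.1 hev
  have hmono : StrictMonoOn m₁ (Metric.ball (0 : ℝ) δ) :=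
    strictMonoOn_of_deriv_pos (convex_ball (0 : ℝ) δ) hm₁s.continuous.continuousOn
      (fun t ht ↦ hδ' t (interior_subset ht))
  refine ⟨μ, fun v hv ↦ ?_, δ, hδ, fun c c' hc hc' h ↦ ?_⟩
  · -- immersion: `fderiv m 0 v = κ v₀ ≠ 0`
    have hv0 : v 0 ≠ 0 := by
      intro h
      apply hv
      ext i
      fin_cases i
      simpa using h
    have hproj : HasFDerivAt (𝕜 := ℝ) (fun c : EuclideanSpace ℝ (Fin 1) ↦ c 0)
        (PiLp.proj (𝕜 := ℝ) 2 (fun _ : Fin 1 ↦ ℝ) 0) 0 :=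
      PiLp.hasFDerivAt_apply 2 (0 : EuclideanSpace ℝ (Fin 1)) 0
    have hm₁d' : HasDerivAt m₁ κ ((fun c : EuclideanSpace ℝ (Fin 1) ↦ c 0) 0) := by
      show HasDerivAt m₁ κ 0
      rw [← hderiv0]
      exact (hm₁s.differentiable (by simp) 0).hasDerivAt
    have hcomp : HasFDerivAt (fun c : EuclideanSpace ℝ (Fin 1) ↦ m₁ (c 0))
        (κ • PiLp.proj (𝕜 := ℝ) 2 (fun _ : Fin 1 ↦ ℝ) 0) 0 := by
      have hcomp0 := hm₁d'.comp_hasFDerivAt (0 : EuclideanSpace ℝ (Fin 1)) hproj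
      exact hcomp0
    rw [hm_eq, hcomp.fderiv, FunLike.coe_smul, Pi.smul_apply, PiLp.proj_apply, smul_eq_mul]
    exact mul_ne_zero hκ0.ne' hv0
  · -- injectivity on the ball `‖c‖ < δ`
    have h' : m₁ (c 0) = m₁ (c' 0) := by
      have hc1 := congrFun hm_eq c
      have hc2 := congrFun hm_eq c'
      simp only at hc1 hc2
      rw [← hc1, ← hc2]
      exact h
    have hb : c 0 ∈ Metric.ball (0 : ℝ) δ :=
      mem_ball_zero_iff.2 (by rw [Real.norm_eq_abs, ← hnorm]; exact hc)
    have hb' : c' 0 ∈ Metric.ball (0 : ℝ) δ :=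
      mem_ball_zero_iff.2 (by rw [Real.norm_eq_abs, ← hnorm]; exact hc')
    have key : c 0 = c' 0 := hmono.injOn hb hb' h'
    rw [← hce₀ c, ← hce₀ c', key]

/-! ### Geometry: smooth coefficients, the sheared family, the inverse diffeomorphism -/

section Geometry

variable {X : Type} [TopologicalSpace X] [ChartedSpace E3 X] [IsManifold (𝓡 3) ∞ X]

/-- **A scalar component of a jointly smooth family of data is smooth in the parameter**:
`c ↦ h_{G c}(x₀)(v₀, w₀)` is `C^∞` (read the family in the trivialisation of `TX` at `x₀`,
`contMDiffAt_bilin_iff`). -/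
private theorem contDiff_h_inner_family {m : ℕ}
    {G : EuclideanSpace ℝ (Fin m) → InitialDataSet (𝓡 3) X}
    (hG : InitialDataSet.IsSmoothDataFamily m G) (x₀ : X) (v₀ w₀ : TangentSpace (𝓡 3) x₀) :
    ContDiff ℝ ∞ (fun c : EuclideanSpace ℝ (Fin m) ↦ (G c).h.inner x₀ v₀ w₀) := by
  -- adapted from `Theorems/RobustClausewiseGenericityGaugeEnrichment.lean` (the block `hF`)
  set T := trivializationAt E3 (TangentSpace (𝓡 3) : X → Type _) x₀ with hT
  have h1 : ContMDiff 𝓘(ℝ, EuclideanSpace ℝ (Fin m)) ((𝓡 3).prod 𝓘(ℝ, E3 →L[ℝ] E3 →L[ℝ] ℝ)) ∞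
      (fun c : EuclideanSpace ℝ (Fin m) ↦ TotalSpace.mk' (E3 →L[ℝ] E3 →L[ℝ] ℝ)
        (E := fun x : X ↦ TangentSpace (𝓡 3) x →L[ℝ] TangentSpace (𝓡 3) x →L[ℝ] ℝ) x₀
        ((G c).h.inner x₀)) :=
    hG.1.comp (contMDiff_id.prodMk contMDiff_const)
  have h2 : ContMDiff 𝓘(ℝ, EuclideanSpace ℝ (Fin m)) 𝓘(ℝ, E3 →L[ℝ] E3 →L[ℝ] ℝ) ∞
      (fun c : EuclideanSpace ℝ (Fin m) ↦ (ContinuousLinearMap.precomp ℝ (T.symmL ℝ x₀)).comp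
        (((G c).h.inner x₀).comp (T.symmL ℝ x₀))) := fun c ↦
    ((contMDiffAt_bilin_iff (IX := 𝓘(ℝ, EuclideanSpace ℝ (Fin m))) (IB := 𝓡 3)
      (V := (TangentSpace (𝓡 3) : X → Type _)) (b := fun _ : EuclideanSpace ℝ (Fin m) ↦ x₀)
      (s := fun c : EuclideanSpace ℝ (Fin m) ↦ (G c).h.inner x₀) (x₀ := c)).1 (h1 c)).2
  have h3 : ContDiff ℝ ∞ (fun c : EuclideanSpace ℝ (Fin m) ↦
      (ContinuousLinearMap.precomp ℝ (T.symmL ℝ x₀)).comp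
        (((G c).h.inner x₀).comp (T.symmL ℝ x₀))) :=
    contMDiff_iff_contDiff.1 h2
  have hx₀T : x₀ ∈ T.baseSet := FiberBundle.mem_baseSet_trivializationAt' x₀
  have hsv : T.symmL ℝ x₀ (T.continuousLinearMapAt ℝ x₀ v₀) = v₀ :=
    T.symmL_continuousLinearMapAt hx₀T v₀
  have hsw : T.symmL ℝ x₀ (T.continuousLinearMapAt ℝ x₀ w₀) = w₀ :=
    T.symmL_continuousLinearMapAt hx₀T w₀
  have h4 : (fun c : EuclideanSpace ℝ (Fin m) ↦ (G c).h.inner x₀ v₀ w₀) =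
      fun c ↦ ((ContinuousLinearMap.precomp ℝ (T.symmL ℝ x₀)).comp
        (((G c).h.inner x₀).comp (T.symmL ℝ x₀))) (T.continuousLinearMapAt ℝ x₀ v₀)
          (T.continuousLinearMapAt ℝ x₀ w₀) := by
    funext c
    simp only [ContinuousLinearMap.coe_comp, Function.comp_apply,
      ContinuousLinearMap.precomp_apply, hsv, hsw]
  rw [h4]
  exact (h3.clm_apply contDiff_const).clm_apply contDiff_const

omit [IsManifold (𝓡 3) ∞ X] in
/-- **The differentials of the inverse of a both-ways-smooth homeomorphism are injective**: from
`Φ ∘ Φ⁻¹ = id`, `dΦ ∘ dΦ⁻¹ = id` (chain rule and uniqueness of the derivative). -/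
private theorem injective_mfderiv_symm_of_contMDiff_homeomorph (Φ : X ≃ₜ X)
    (hΦ : ContMDiff (𝓡 3) (𝓡 3) (∞ + 1) Φ) (hΨ : ContMDiff (𝓡 3) (𝓡 3) (∞ + 1) Φ.symm) (u : X) :
    Injective (mfderiv (𝓡 3) (𝓡 3) Φ.symm u) := by
  -- adapted from `Theorems/PhaseMixingCaptureCaptureSufficesC2StubSelfWitnesses.lean`
  have hd1 : MDifferentiableAt (𝓡 3) (𝓡 3) Φ (Φ.symm u) :=
    (hΦ.of_le le_self_add).mdifferentiableAt (by simp)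
  have hd2 : MDifferentiableAt (𝓡 3) (𝓡 3) Φ.symm u :=
    (hΨ.of_le le_self_add).mdifferentiableAt (by simp)
  have hcomp : HasMFDerivAt (𝓡 3) (𝓡 3) (⇑Φ ∘ ⇑Φ.symm) u
      ((mfderiv (𝓡 3) (𝓡 3) Φ (Φ.symm u)).comp (mfderiv (𝓡 3) (𝓡 3) Φ.symm u)) :=
    hd1.hasMFDerivAt.comp u hd2.hasMFDerivAt
  have hid : HasMFDerivAt (𝓡 3) (𝓡 3) (⇑Φ ∘ ⇑Φ.symm) u
      (ContinuousLinearMap.id ℝ (TangentSpace (𝓡 3) u)) := by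
    have h := hasMFDerivAt_id (I := 𝓡 3) u
    exact h.congr_of_eventuallyEq (Eventually.of_forall fun x ↦ Φ.apply_symm_apply x)
  have heq : (mfderiv (𝓡 3) (𝓡 3) Φ (Φ.symm u)).comp (mfderiv (𝓡 3) (𝓡 3) Φ.symm u) =
      ContinuousLinearMap.id ℝ (TangentSpace (𝓡 3) u) :=
    hcomp.mfderiv.symm.trans hid.mfderiv
  intro v w hvw
  have h := congrArg (mfderiv (𝓡 3) (𝓡 3) Φ (Φ.symm u)) hvw
  rw [← ContinuousLinearMap.comp_apply, ← ContinuousLinearMap.comp_apply, heq] at h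
  exact h

variable [T2Space X] {e : AFEnd X} {z₀ : E3} {r : ℝ} (B : BreathingData e z₀ r)

/-- **The sheared family is jointly smooth**: for a jointly smooth `G : ℝ¹ → data`, a smooth
`φ : ℝ¹ → ℝ¹` and a real `μ`, the family `c ↦ (breathe (σ (μ (φ c)₀)))^* (G (φ c))` is jointly
smooth (`AFEnd.contMDiff_breatheFamily_family_h/k` with `pr := φ`, `τ c := μ (φ c)₀`). -/
private theorem isSmoothDataFamily_shear
    {G : EuclideanSpace ℝ (Fin 1) → InitialDataSet (𝓡 3) X}
    (hG : InitialDataSet.IsSmoothDataFamily 1 G)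
    {φ : EuclideanSpace ℝ (Fin 1) → EuclideanSpace ℝ (Fin 1)} (hφ : ContDiff ℝ ∞ φ) (μ : ℝ) :
    InitialDataSet.IsSmoothDataFamily 1
      (fun c : EuclideanSpace ℝ (Fin 1) ↦ breatheFamily B (G (φ c)) (μ * φ c 0)) := by
  have hτ : ContDiff ℝ ∞ (fun c : EuclideanSpace ℝ (Fin 1) ↦ μ * φ c 0) :=
    contDiff_const.mul
      ((contDiff_piLp_apply (𝕜 := ℝ) (n := ∞) (p := 2) (E := fun _ : Fin 1 => ℝ) (i := 0)).comp hφ)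
  exact ⟨contMDiff_breatheFamily_family_h B (pr := φ)
      (τ := fun c : EuclideanSpace ℝ (Fin 1) ↦ μ * φ c 0) (G := G) hφ hτ hG.1,
    contMDiff_breatheFamily_family_k B (pr := φ)
      (τ := fun c : EuclideanSpace ℝ (Fin 1) ↦ μ * φ c 0) (G := G) hφ hτ hG.2⟩

end Geometry

/-! ### The registered stub -/

/-- **The gauge shear** (registered stub `stub_shearInjImm` of the line `Sketch` of the crux
`PhotonSphereChannels.TameCensorship`): for a property `P` of data preserved under re-indexing an
admissible datum by a diffeomorphism of `Σ` (`InitialDataSet.comap` along a homeomorphism smooth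
with injective differentials, inverse likewise), every jointly smooth one-parameter family `G` of
admissible data whose members with `0 < ‖c‖ < ε` have `P` is sheared into a jointly smooth family
`F` through the same base datum, INJECTIVE and IMMERSED at `0`, admissible, with `P` at every
`c ≠ 0`, whose member at `c` agrees with the reparametrised member `G (φ c)` (`φ` smooth,
`φ 0 = 0`) off one compact set. `F c := (breathe (σ (μ (φ c)₀)))^* (G (φ c))` on a coordinate ball
far out on the end of `G 0`, `μ` from `marker_shear` applied to `A c := h_{G c}(x₀)(v₀, v₀)` and
`σ` the squashing, `φ` the radial contraction into the `min ε δ`-ball. -/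
theorem stub_shearInjImm :
    ∀ (X : Type) [TopologicalSpace X] [ChartedSpace E3 X] [IsManifold (𝓡 3) ∞ X] [T2Space X]
      [SecondCountableTopology X] [ConnectedSpace X]
      (P : InitialDataSet (𝓡 3) X → Prop),
      (∀ (D : InitialDataSet (𝓡 3) X) (Φ : X ≃ₜ X) (hΦ : ContMDiff (𝓡 3) (𝓡 3) (∞ + 1) Φ)
          (hΦ' : ∀ u, Injective (mfderiv (𝓡 3) (𝓡 3) Φ u)),
          ContMDiff (𝓡 3) (𝓡 3) (∞ + 1) Φ.symm → (∀ u, Injective (mfderiv (𝓡 3) (𝓡 3) Φ.symm u)) →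
            D ∈ admissibleVacuumData X → P D → P (D.comap Φ hΦ hΦ')) →
      ∀ (G : EuclideanSpace ℝ (Fin 1) → InitialDataSet (𝓡 3) X),
        InitialDataSet.IsSmoothDataFamily 1 G → (∀ c, G c ∈ admissibleVacuumData X) →
        (∃ ε : ℝ, 0 < ε ∧ ∀ c, c ≠ 0 → ‖c‖ < ε → P (G c)) →
        ∃ (F : EuclideanSpace ℝ (Fin 1) → InitialDataSet (𝓡 3) X)
          (φ : EuclideanSpace ℝ (Fin 1) → EuclideanSpace ℝ (Fin 1)) (K : Set X),
          ContDiff ℝ ∞ φ ∧ φ 0 = 0 ∧ IsCompact K ∧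
          InitialDataSet.IsSmoothDataFamily 1 F ∧ Injective F ∧ InitialDataSet.IsImmersedAtZero 1 F ∧
          F 0 = G 0 ∧ (∀ c, F c ∈ admissibleVacuumData X) ∧
          (∀ c, ∀ x ∉ K, (F c).h.inner x = (G (φ c)).h.inner x ∧ (F c).k x = (G (φ c)).k x) ∧
          ∀ c, c ≠ 0 → P (F c) := by
  intro X _ _ _ _ _ _ P hP G hG hadm hPε
  obtain ⟨ε, hε, hPε⟩ := hPε
  -- the asymptotically flat end of `G 0` and a breathing ball far out on it
  obtain ⟨-, e, -, -, -⟩ := hadm 0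
  set z₀ : E3 := (e.R + 3) • EuclideanSpace.single (0 : Fin 3) (1 : ℝ) with hz₀
  have hz₀n : ‖z₀‖ = e.R + 3 := by
    rw [hz₀, norm_smul, PiLp.norm_single, norm_one, mul_one,
      Real.norm_of_nonneg (by linarith [e.R_pos])]
  have B : e.BreathingData z₀ 1 := ⟨one_pos, by rw [hz₀n]; linarith⟩
  -- the centre, a non-zero tangent vector there, and the coefficient `A c := h_{G c}(x₀)(v₀, v₀)`
  set x₀ : X := e.dataChartExt z₀ with hx₀
  set v₀ : TangentSpace (𝓡 3) x₀ := (EuclideanSpace.single (0 : Fin 3) (1 : ℝ) : E3) with hv₀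
  have hv₀ne : v₀ ≠ 0 := by
    have h : (EuclideanSpace.single (0 : Fin 3) (1 : ℝ) : E3) ≠ 0 := by
      rw [← norm_ne_zero_iff, PiLp.norm_single, norm_one]
      exact one_ne_zero
    exact h
  have hmark : ∀ (d : InitialDataSet (𝓡 3) X) (t : ℝ),
      (breatheFamily B d t).h.inner x₀ v₀ v₀ = (1 + squash B t) ^ 2 * d.h.inner x₀ v₀ v₀ :=
    fun d t ↦ breatheFamily_h_inner_center B d t v₀ v₀
  have hA : ContDiff ℝ ∞ (fun c : EuclideanSpace ℝ (Fin 1) ↦ (G c).h.inner x₀ v₀ v₀) :=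
    contDiff_h_inner_family hG x₀ v₀ v₀
  have hA0 : 0 < (G 0).h.inner x₀ v₀ v₀ := (G 0).h.pos x₀ v₀ hv₀ne
  -- the squashing `σ` has `σ'(0) = s₀ / π > 0`
  have hsq : HasDerivAt (squash B) (breatheScale B / Real.pi) 0 := by
    have h := (Real.hasDerivAt_arctan 0).const_mul (breatheScale B / Real.pi)
    simp only [ne_eq, OfNat.ofNat_ne_zero, not_false_eq_true, zero_pow, add_zero, div_one,
      mul_one] at h
    exact h
  have hs : 0 < breatheScale B / Real.pi := div_pos (breatheScale_spec B).1 Real.pi_pos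
  -- the shear rate `μ` and the injectivity radius `δ`
  obtain ⟨μ, himm, δ, hδ, hinj⟩ :=
    marker_shear (contDiff_squash B) hsq hs (squash_zero B) hA hA0
  -- the radial contraction into the `min ε δ`-ball
  have hρ : 0 < min ε δ := lt_min hε hδ
  obtain ⟨φ, hφ, hφinj, hφ0, hball, hφne, hdφ⟩ :=
    exists_contDiff_radialContraction (V := EuclideanSpace ℝ (Fin 1)) hρ
  have hdinj : Injective (fderiv ℝ φ 0) := by
    rw [hdφ]
    intro v w h
    simpa [hρ.ne'] using h
  -- breathing members of admissible data are admissible, and inherit `P`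
  have hadmB : ∀ d ∈ admissibleVacuumData X, ∀ t : ℝ,
      breatheFamily B d t ∈ admissibleVacuumData X := by
    intro d hd t
    refine InitialDataSet.mem_admissibleVacuumData_of_agree_off_compact hd ?_
      (isCompact_breatheCore B) (fun x hx ↦ breatheFamily_eq_of_not_mem_core B d t hx)
    intro inst
    haveI : d.metric.HasLeviCivita := d.metric.hasLeviCivita
    exact isVacuumConstraintSolution_breatheFamily B d hd.1.1 t
  have hPB : ∀ d ∈ admissibleVacuumData X, P d → ∀ t : ℝ, P (breatheFamily B d t) := by
    intro d hd hPd t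
    set Φ : X ≃ₜ X := breatheHomeomorph B (abs_squash_lt_invScale B t) with hΦdef
    have hΦ : ContMDiff (𝓡 3) (𝓡 3) (∞ + 1) Φ :=
      contMDiff_breathe_succ B (abs_squash_lt_scale B t).2
    have hΦ' : ∀ u, Injective (mfderiv (𝓡 3) (𝓡 3) Φ u) :=
      (breatheScale_spec B).2.2 _ (abs_squash_lt_scale B t).1
    have hΨ : ContMDiff (𝓡 3) (𝓡 3) (∞ + 1) Φ.symm := contMDiff_unbreathe B _
    have hΨ' : ∀ u, Injective (mfderiv (𝓡 3) (𝓡 3) Φ.symm u) :=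
      injective_mfderiv_symm_of_contMDiff_homeomorph Φ hΦ hΨ
    have key : breatheFamily B d t = d.comap Φ hΦ hΦ' := rfl
    rw [key]
    exact hP d Φ hΦ hΦ' hΨ hΨ' hd hPd
  -- the pre-family `F₀ c := E_{μ c₀}(G c)` is immersed at `0`
  have himm₀ : InitialDataSet.IsImmersedAtZero 1
      (fun c : EuclideanSpace ℝ (Fin 1) ↦ breatheFamily B (G c) (μ * c 0)) := by
    intro v hv
    refine ⟨x₀, v₀, v₀, Or.inl ?_⟩
    have hline : (fun c : EuclideanSpace ℝ (Fin 1) ↦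
        (breatheFamily B (G c) (μ * c 0)).h.inner x₀ v₀ v₀) =
        fun c ↦ (1 + squash B (μ * c 0)) ^ 2 * (G c).h.inner x₀ v₀ v₀ :=
      funext fun c ↦ hmark (G c) (μ * c 0)
    rw [hline]
    exact himm v hv
  -- THE SHEARED FAMILY `F c := E_{μ (φ c)₀}(G (φ c))`
  refine ⟨fun c ↦ breatheFamily B (G (φ c)) (μ * φ c 0), φ, breatheCore e z₀ 1, hφ, hφ0,
    isCompact_breatheCore B, isSmoothDataFamily_shear B hG hφ μ, ?_, ?_, ?_,
    fun c ↦ hadmB _ (hadm (φ c)) _,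
    fun c x hx ↦ breatheFamily_eq_of_not_mem_core B (G (φ c)) _ hx, fun c hc ↦ ?_⟩
  · -- injective: the marker separates members with parameters in the `δ`-ball, `φ` is injective
    intro c c' h
    have h' := congrArg (fun D : InitialDataSet (𝓡 3) X ↦ D.h.inner x₀ v₀ v₀) h
    simp only at h'
    rw [hmark, hmark] at h'
    exact hφinj (hinj (φ c) (φ c') ((hball c).trans_le (min_le_right _ _))
      ((hball c').trans_le (min_le_right _ _)) h')
  · -- immersed at `0`
    exact himm₀.comp_of_injective_fderiv hφ0 (hφ.differentiable (by simp) 0) hdinj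
  · -- through the base datum
    show breatheFamily B (G (φ 0)) (μ * φ 0 0) = G 0
    have h00 : ((0 : EuclideanSpace ℝ (Fin 1)) 0 : ℝ) = 0 := rfl
    rw [hφ0, h00, mul_zero, breatheFamily_zero]
  · -- `P` off `0`: `0 < ‖φ c‖ < ε`
    exact hPB _ (hadm (φ c)) (hPε (φ c) (fun h ↦ hc (hφne c h))
      ((hball c).trans_le (min_le_left _ _))) _

end Summit.FinalStateConjecture.FinalStateConjecture.Theorems.PhotonSphereChannels.TameCensorshipUnwind

end
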